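import Summits.QuantumFields.BalabanUV.Beta.GAN24.CouplingPerturbedVolumeLimit
import Summits.QuantumFields.BalabanUV.Beta.GAN24.CovariantLaplacianTaylorLine

/-!
# `BalabanUV.Beta.GAN24.CouplingEffectiveFormVolumeLimit` — binder row G-an2-4 ∕ (CONV-C), route R7 «TWO CURRENCIES», PART 250: THE VALUE SECTOR FOR COUPLING LETTERS, THE END —
# PART 152 §3 VERBATIM for COUPLING letters: EL₂ of `c_k(u)⁻¹` and of the effective form `Σ_k(u) = c_k(u)⁻¹ − a″1`, and **`conv_effFormPert_coupling_of_tendsto_background`** — on PART 248's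
# coupling disc `‖u‖ ≤ T` the effective form WITH a coupling-letter background (ALL orders in `u`, NO expansion) has the β-cell's whole `LimitRate` END on `ℤ^d` modulo ONLY EL₁ of
# `V₁, V₂, W`; §2 THE INSTANCE: `u ↦ Δ_a + u·(Δ^{U_t} − Δ^1)` for a volume-indexed family of abelian transporters — THE EFFECTIVE FORM OF THE (SMALL-FIELD) ABELIAN COVARIANT VECTOR LAPLACIAN
# ITSELF, at every coupling of the disc (the physical `u = 1` when `T ≥ 1` is admissible, i.e. for small `(α, β, α′, β′)`), displaying only EL₁ of the transporters (unit b2b-balaban-gan24-p3,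
# gen 65; v1; generator `HOME/b2b-balaban-gan24-p3/gen65/records/gen/gen249.py` over the tree text of PART 152)

NOT IN PRINT; OUR PROOF ([folklore] bookkeeping BY NAME over PART 151 (`pertInv_eq`, `one_sub_one_smul`, `one_add_smul_eq`, `tendsto_avgTow_pair_of_fine`), PART 152 (`avgTow_inv_calDalev_eq`,
`one_sub_half_ratio_lt_one`), PART 236 (`norm_couplingLetter_mul_apply_le`, `tendsto_couplingLetter_mul_pair`, `perturbationLaws_couplingLetter`, `hPc_couplingLetter`), PART 144, PART 145 ∕ 146,
PART 138, PART 129 (`hdecB_pert_of_wCoercive`), NE2's `opNorm_avgTow_perturbed_sub_le`; [Balaban1987RG1] p. 264 LOCATES the `T ↗ ℤ^d` limit; nothing printed is a hypothesis).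
HONEST FRAMING (cell contract, verbatim): «discharging `BetaPertH` makes Bałaban's UV stability UNCONDITIONAL — a real constructive-QFT result; it is NOT the
continuum limit and NOT the Clay problem.»  HONEST DEPENDENCY (verbatim): «continuum YM on T⁴ ⇐ BetaPertH ∧ nine spine estimates (0/9 proved); BetaPertH ⇐
(D1) ∧ (D4) ∧ CAP+tail; G-an2-4 gates asym, D1 and NE2/3/4.»

WHAT THIS FILE PROVES (0 sorry, 0 `def`; `d ≥ 3`, `L ≥ 2`, PART 248's disc: admissible `κ` at `a′`, `Tκ₀ ≤ 1∕2`, `Tκ_c ≤ 1∕2`, `4Tκ₀Cst ≤ γ_B`):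
* §1 **`tendsto_inv_pertCov_pair_coupling`**, **`tendsto_effFormPert_pair_coupling`**, **`conv_effFormPert_coupling_of_tendsto_background`** (`∃ δ₀ > 0, B, B′ ≥ 0, Π` with `IsInfiniteVolumeLimit`,
  `UniformDecay`, `StepRate (√(L⁻¹))`, `KernelInputs`, `|secondMoment (Π k) − secondMoment (lim Π)| ≤ β′_d(B′∕(1−√(L⁻¹)), δ₀∕d)(√(L⁻¹))^k` for `Σ_k(u)`, every `‖u‖ ≤ T`, every `a″`).
* §2 **`conv_effForm_covariantLaplacian_of_tendsto`** — the same along `u ↦ Δ_a + u·covPert U_t` (NE2's exact `Δ^U − Δ^1`), displaying only EL₁ of the transporters.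
WHAT IT DOES NOT DO: couplings outside the disc; Bałaban's `−∂P∂*` ∕ `aQ(U)*Q(U)` parts; colour.  SUPPLIER work; NEVER «G-an2-4 closed»; NOT (CONV-C), NOT D1, NOT `BetaPertH`, NOT continuum,
NOT Clay.  Records: `HOME/b2b-balaban-gan24-p3/gen65/README.md`.
-/

noncomputable section

open scoped BigOperators ComplexConjugate Matrix Matrix.Norms.L2Operator
open Filter Topology

namespace Summit.QuantumFields.BalabanUV.Beta.GAN24.CouplingEffectiveFormVolumeLimit

open Literature.MathematicalPhysics.QuantumFieldTheory.Balaban1983to89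
open Literature.MathematicalPhysics.QuantumFieldTheory.Balaban1983to89.B5Prop11Plancherel (Tor fine fdiff shiftM unitVec Cst Cst_nonneg opNorm_reindex)
open Literature.MathematicalPhysics.QuantumFieldTheory.Balaban1983to89.B5Block118 (QvOp bpt tstep)
open Literature.MathematicalPhysics.QuantumFieldTheory.Balaban1983to89.B5G183RateUnitTower (lev)
open Literature.MathematicalPhysics.QuantumFieldTheory.Balaban1983to89.B12Sec2to5 (l1 betaPrime510)
open Literature.MathematicalPhysics.QuantumFieldTheory.Balaban1983to89.Beta (Site windowMap IsInfiniteVolumeLimit)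
open Literature.MathematicalPhysics.QuantumFieldTheory.Balaban1983to89.Beta.FreeLegDictionary (cubic)
open Literature.MathematicalPhysics.QuantumFieldTheory.Balaban1983to89.Beta.BlockKernelVolumeSockets (evenPeriod tendsto_evenPeriod)
open Literature.MathematicalPhysics.QuantumFieldTheory.Balaban1983to89.Beta.VectorTails (castT castT_add castT_neg castT_single)
open Literature.MathematicalPhysics.QuantumFieldTheory.Balaban1983to89.Beta.VectorTailsPt (shiftM_mul_apply)
open Summit.QuantumFields.BalabanUV.T4Continuum
open Summit.QuantumFields.BalabanUV.T4Continuum.CovariantAveragingTower (avgTow)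
open Summit.QuantumFields.BalabanUV.T4Continuum.BalabanAveragedTowerUnit (idx QBlev calGlev one_le_lev' norm_entry_le_opNorm unitCovB opNorm_QBlev_sq_le)
open Summit.QuantumFields.BalabanUV.T4Continuum.BalabanAveragedCoerciveTower (unitIdx)
open Summit.QuantumFields.BalabanUV.T4Continuum.KingPairingPlantedLaw (calDalev calDalev_inv isUnit_det_calDalev opNorm_inv_calDalev_le)
open Summit.QuantumFields.BalabanUV.T4Continuum.FirstOrderBackgroundModel (LipschitzBackground Pmodel firstOrder)
open Summit.QuantumFields.BalabanUV.T4Continuum.BackgroundResolventLaw (add_smul_eq_mul_right opNorm_smul_le_of_le opNorm_inv_one_add_le)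
open Summit.QuantumFields.BalabanUV.Beta.GAN24.VolumeLimitCovariance (QGQ_apply bpt_castT_add_tstep one_sub_smul_reindex opNorm_one_sub_smul_unitCovB_le)
open Summit.QuantumFields.BalabanUV.Beta.GAN24.DiagramVolumeLimitPairs (l1_windowMap_sub_castT_ge l1_windowMap_neg norm_le_exp_window_of_entryDecay)
open Summit.QuantumFields.BalabanUV.Beta.GAN24.VolumeLimitPairsFibre (tendsto_mul_pair' exists_tendsto_inv_pair norm_one_sub_smul_apply_le tendsto_one_sub_smul_pair)
open Summit.QuantumFields.BalabanUV.Beta.GAN24.FinePropagatorDecay (exists_fineWindowDecay_calGlev)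
open Summit.QuantumFields.BalabanUV.Beta.GAN24.FineInsertionVolumeLimit (tendsto_calGlev_pair reindex_avgTow_eq)
open Literature.MathematicalPhysics.QuantumFieldTheory.Balaban1983to89.Beta.LimitRate (StepRate limKernelOf KernelInputs)
open Summit.QuantumFields.BalabanUV.T4Continuum.CoerciveInverseTower (Coercive)
open Summit.QuantumFields.BalabanUV.T4Continuum.BalabanAveragedCoercive (gammaB gammaB_pos)
open Summit.QuantumFields.BalabanUV.T4Continuum.BackgroundResolventTower (opNorm_avgTow_perturbed_sub_le)
open Summit.QuantumFields.BalabanUV.T4Continuum.CTWeightedCoercivity (conjMat WCoercive)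
open Summit.QuantumFields.BalabanUV.T4Continuum.CTKingTowerWeights (rho distK)
open Summit.QuantumFields.BalabanUV.T4Continuum.CTConjugatedHbd (G2 G2_nonneg wCoercive_calDa_of_conjDefect)
open Summit.QuantumFields.BalabanUV.T4Continuum.CTConjDefectDischarge (conjDefect_calDalev_rho max_JA_lt_gamD)
open Summit.QuantumFields.BalabanUV.T4Continuum.DirichletRegionTower (gamD gamD_pos)
open Summit.QuantumFields.BalabanUV.T4Continuum.ScalarAveragedPropagator (gammaPs)
open Summit.QuantumFields.BalabanUV.T4Continuum.ScalarAveragedCompression (sigma0)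
open Summit.QuantumFields.BalabanUV.T4Continuum.CTScalarGreen (Jfree)
open Summit.QuantumFields.BalabanUV.T4Continuum.CTGaugeTerm (deltaK)
open Summit.QuantumFields.BalabanUV.T4Continuum.CTVectorPropagator (JA)
open Summit.QuantumFields.BalabanUV.T4Continuum.DecayRateInterpolation (EntryDecay TwoLevelDecayRate entryDecay_sub)
open Summit.QuantumFields.BalabanUV.Beta.GAN24.EffectiveFormDecayBackground (hdecB_pert_of_wCoercive exists_decay_inv_pertCov_QB twoLevelDecayRate_effForm_perturbed)
open Summit.QuantumFields.BalabanUV.Beta.GAN24.UnitLatticeDecayAlgebra (distK_nonneg distK_self entryDecay_smul entryDecay_one)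
open Summit.QuantumFields.BalabanUV.Beta.GAN24.EffectiveFormDecay (entryDecay_of_le_rate)
open Summit.QuantumFields.BalabanUV.Beta.GAN24.DiagramDecayAlgebra (twoLevelDecayRate_of_le_rate)
open Summit.QuantumFields.BalabanUV.Beta.GAN24.DiagramVolumeLimitSandwich (tendsto_one_pair)
open Summit.QuantumFields.BalabanUV.Beta.GAN24.DiagramVolumeLimit (conv_of_decay_of_tendsto)
open Summit.QuantumFields.BalabanUV.T4Continuum.PerturbationAlgebra (BoundedBackground)
open Summit.QuantumFields.BalabanUV.Beta.GAN24.CouplingLetterStencil (norm_couplingLetter_mul_apply_le tendsto_couplingLetter_mul_pair perturbationLaws_couplingLetter hPc_couplingLetter)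
open Summit.QuantumFields.BalabanUV.Beta.GAN24.PerturbedPropagatorVolumeLimit (pertInv_eq one_sub_one_smul one_add_smul_eq tendsto_avgTow_pair_of_fine)
open Summit.QuantumFields.BalabanUV.Beta.GAN24.PerturbedEffectiveFormVolumeLimit (avgTow_inv_calDalev_eq one_sub_half_ratio_lt_one castT_zero)
open Summit.QuantumFields.BalabanUV.Beta.GAN24.CouplingEffectiveFormDecay (exists_decay_inv_pertCov_QB_coupling twoLevelDecayRate_effForm_perturbed_coupling)
open Summit.QuantumFields.BalabanUV.T4Continuum.AbelianCovariantLaplacian (covPert connV zT covPert_eq)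
open Summit.QuantumFields.BalabanUV.Beta.GAN24.CovariantLaplacianTaylorLine (tendsto_connV_of_tendsto tendsto_zT_of_tendsto)
open Summit.QuantumFields.BalabanUV.Beta.GAN24.CouplingPerturbedVolumeLimit (tendsto_pertCov_pair_coupling opNorm_one_sub_smul_pertCov_le_coupling exists_windowDecay_pertCov_coupling)

variable {d : ℕ} (L : ℕ) [NeZero L]

/-! ## §1 EL₂ of `c_k(u)⁻¹`, of `Σ_k(u)`, and the END, for coupling letters -/

section EffForm

variable (a : ℝ) (ha : 0 < a)

/-- **`tendsto_inv_pertCov_pair` — EL₂ OF THE INVERSE PERTURBED BLOCK COVARIANCE** [our proof] (`d ≥ 3`, `a > 0`, level `k`, even cubic volumes, PART 129's disc, `‖u‖ ≤ T`): for a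
volume-indexed family of Lipschitz backgrounds (`α, β` uniform) with EL₁ at level `k`, `∀ μ ν z z′, ∃ s, c_k(u)⁻¹(e(ẑ_t,μ), e(ẑ′_t,ν)) → s` — PART 144's `exists_tendsto_inv_pair` on
`A_t = c_k(u)` read on `Site × Fin d` ((a) §1, (b) §2, (c) PART 151). [cite: Balaban1987RG1, p.264 (after (1.21): the `T ↗ ℤ^d` limit)] -/
theorem tendsto_inv_pertCov_pair_coupling (hd : 3 ≤ d) {α β α' β' a' κ T : ℝ} (ha' : 0 < a') (hκ0 : 0 < κ)
    (hγ' : Jfree d a' κ 1 < gammaPs d a') (hδ' : deltaK d a' κ 1 < sigma0 d a' ^ 2) (hJA : JA d a a' κ 1 < gamD d a)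
    (hT₁ : T * (2 * (d * (α + β) * Cst d a) + α' * Cst d a) ≤ 1 / 2)
    (hT₂ : T * (d * (α * G2 d a (max (JA d a a' κ 1) 0) (gamD d a - max (JA d a a' κ 1) 0) κ)
      + d * (Real.exp |κ| * (α * G2 d a (max (JA d a a' κ 1) 0) (gamD d a - max (JA d a a' κ 1) 0) κ + β * (gamD d a - max (JA d a a' κ 1) 0)⁻¹))
      + α' * (gamD d a - max (JA d a a' κ 1) 0)⁻¹) ≤ 1 / 2)
    (hT₃ : 4 * T * (2 * (d * (α + β) * Cst d a) + α' * Cst d a) * Cst d a ≤ gammaB d a) (k : ℕ)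
    {V₁ V₂ : (t : ℕ) → (k : ℕ) → Fin d → (idx L (cubic d (evenPeriod t)) k → ℂ)} {W : (t : ℕ) → (k : ℕ) → (idx L (cubic d (evenPeriod t)) k → ℂ)}
    (hV₁ : ∀ t, LipschitzBackground L (cubic d (evenPeriod t)) (V₁ t) α β) (hV₂ : ∀ t, LipschitzBackground L (cubic d (evenPeriod t)) (V₂ t) α β)
    (hW : ∀ t, BoundedBackground L (cubic d (evenPeriod t)) (W t) α' β')
    (hV₁1 : ∀ (μ f : Fin d) (z : Fin d → ℤ), ∃ s : ℂ, Tendsto (fun t => V₁ t k μ (castT (cubic d (lev L k * evenPeriod t)) z, f)) atTop (𝓝 s))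
    (hV₂1 : ∀ (μ f : Fin d) (z : Fin d → ℤ), ∃ s : ℂ, Tendsto (fun t => V₂ t k μ (castT (cubic d (lev L k * evenPeriod t)) z, f)) atTop (𝓝 s))
    (hW1 : ∀ (f : Fin d) (z : Fin d → ℤ), ∃ s : ℂ, Tendsto (fun t => W t k (castT (cubic d (lev L k * evenPeriod t)) z, f)) atTop (𝓝 s))
    {u : ℂ} (hu : ‖u‖ ≤ T) (μ ν : Fin d) (z z' : Fin d → ℤ) :
    ∃ s : ℂ, Tendsto (fun t => (avgTow (QBlev L (cubic d (evenPeriod t))) ((L : ℝ) ^ d)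
        (fun k' => (calDalev L (cubic d (evenPeriod t)) a ha k' + u • (Pmodel L (cubic d (evenPeriod t)) (V₁ t) k' + (Pmodel L (cubic d (evenPeriod t)) (V₂ t) k')ᴴ + Matrix.diagonal (W t k')))⁻¹) k)⁻¹
      ((unitIdx L (cubic d (evenPeriod t))).symm (castT (cubic d (evenPeriod t)) z, μ)) ((unitIdx L (cubic d (evenPeriod t))).symm (castT (cubic d (evenPeriod t)) z', ν)))
      atTop (𝓝 s) := by
  have hd1 : 1 ≤ d := le_trans (by norm_num) hd
  have hd0 : (0 : ℝ) < d := by exact_mod_cast lt_of_lt_of_le zero_lt_one hd1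
  have hα : 0 ≤ α := (hV₁ 0).nonneg.1
  have hβ : 0 ≤ β := (hV₁ 0).nonneg.2
  have hα' : 0 ≤ α' := (hW 0).nonneg.1
  have hκ₀0 : 0 ≤ 2 * (d * (α + β) * Cst d a) + α' * Cst d a := by have := Cst_nonneg d a; positivity
  have hTκ : T * (2 * (d * (α + β) * Cst d a) + α' * Cst d a) < 1 := by linarith
  obtain ⟨Bc, hBc0, hdec⟩ := exists_windowDecay_pertCov_coupling L a ha (β' := β') hα hβ hα' ha' hκ0 hγ' hδ' hJA hT₂
  have hδ : 0 < κ / d := div_pos hκ0 hd0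
  obtain ⟨s, hs⟩ := exists_tendsto_inv_pair (d := d) (F := Fin d) (side := evenPeriod) tendsto_evenPeriod
    (A := fun t => Matrix.reindex (unitIdx L (cubic d (evenPeriod t))) (unitIdx L (cubic d (evenPeriod t)))
      (avgTow (QBlev L (cubic d (evenPeriod t))) ((L : ℝ) ^ d)
        (fun k' => (calDalev L (cubic d (evenPeriod t)) a ha k' + u • (Pmodel L (cubic d (evenPeriod t)) (V₁ t) k' + (Pmodel L (cubic d (evenPeriod t)) (V₂ t) k')ᴴ + Matrix.diagonal (W t k')))⁻¹) k))
    (τ := (((Cst d a)⁻¹ : ℝ) : ℂ)) (fun t => opNorm_one_sub_smul_pertCov_le_coupling L (cubic d (evenPeriod t)) a ha hd1 (hV₁ t) (hV₂ t) (hW t) hT₁ hT₃ hu k)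
    (one_sub_half_ratio_lt_one a ha) (fun t w g y h => hdec (evenPeriod t) (V₁ t) (V₂ t) (W t) (hV₁ t) (hV₂ t) (hW t) u hu k w g y h) hδ
    (fun f g w w' => tendsto_pertCov_pair_coupling L a ha hd hTκ k hV₁ hV₂ hW hV₁1 hV₂1 hW1 hu f g w w') μ ν z z'
  refine ⟨s, hs.congr fun t => ?_⟩
  rw [Matrix.inv_reindex]
  simp only [Matrix.reindex_apply, Matrix.submatrix_apply]

/-- **`tendsto_effFormPert_pair` — EL₂ OF THE EFFECTIVE FORM WITH BACKGROUND `Σ_k(u) = c_k(u)⁻¹ − a″·1`** [our proof] (hypotheses of `tendsto_inv_pertCov_pair`, any `a″`).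
[cite: Balaban1987RG1, p.264 (after (1.21): the `T ↗ ℤ^d` limit)] -/
theorem tendsto_effFormPert_pair_coupling (hd : 3 ≤ d) {α β α' β' a' κ T : ℝ} (ha' : 0 < a') (hκ0 : 0 < κ)
    (hγ' : Jfree d a' κ 1 < gammaPs d a') (hδ' : deltaK d a' κ 1 < sigma0 d a' ^ 2) (hJA : JA d a a' κ 1 < gamD d a)
    (hT₁ : T * (2 * (d * (α + β) * Cst d a) + α' * Cst d a) ≤ 1 / 2)
    (hT₂ : T * (d * (α * G2 d a (max (JA d a a' κ 1) 0) (gamD d a - max (JA d a a' κ 1) 0) κ)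
      + d * (Real.exp |κ| * (α * G2 d a (max (JA d a a' κ 1) 0) (gamD d a - max (JA d a a' κ 1) 0) κ + β * (gamD d a - max (JA d a a' κ 1) 0)⁻¹))
      + α' * (gamD d a - max (JA d a a' κ 1) 0)⁻¹) ≤ 1 / 2)
    (hT₃ : 4 * T * (2 * (d * (α + β) * Cst d a) + α' * Cst d a) * Cst d a ≤ gammaB d a) (k : ℕ)
    {V₁ V₂ : (t : ℕ) → (k : ℕ) → Fin d → (idx L (cubic d (evenPeriod t)) k → ℂ)} {W : (t : ℕ) → (k : ℕ) → (idx L (cubic d (evenPeriod t)) k → ℂ)}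
    (hV₁ : ∀ t, LipschitzBackground L (cubic d (evenPeriod t)) (V₁ t) α β) (hV₂ : ∀ t, LipschitzBackground L (cubic d (evenPeriod t)) (V₂ t) α β)
    (hW : ∀ t, BoundedBackground L (cubic d (evenPeriod t)) (W t) α' β')
    (hV₁1 : ∀ (μ f : Fin d) (z : Fin d → ℤ), ∃ s : ℂ, Tendsto (fun t => V₁ t k μ (castT (cubic d (lev L k * evenPeriod t)) z, f)) atTop (𝓝 s))
    (hV₂1 : ∀ (μ f : Fin d) (z : Fin d → ℤ), ∃ s : ℂ, Tendsto (fun t => V₂ t k μ (castT (cubic d (lev L k * evenPeriod t)) z, f)) atTop (𝓝 s))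
    (hW1 : ∀ (f : Fin d) (z : Fin d → ℤ), ∃ s : ℂ, Tendsto (fun t => W t k (castT (cubic d (lev L k * evenPeriod t)) z, f)) atTop (𝓝 s))
    {u : ℂ} (hu : ‖u‖ ≤ T) (a'' : ℂ) (μ ν : Fin d) (z z' : Fin d → ℤ) :
    ∃ s : ℂ, Tendsto (fun t => ((avgTow (QBlev L (cubic d (evenPeriod t))) ((L : ℝ) ^ d)
        (fun k' => (calDalev L (cubic d (evenPeriod t)) a ha k' + u • (Pmodel L (cubic d (evenPeriod t)) (V₁ t) k' + (Pmodel L (cubic d (evenPeriod t)) (V₂ t) k')ᴴ + Matrix.diagonal (W t k')))⁻¹) k)⁻¹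
        - a'' • (1 : Matrix (idx L (cubic d (evenPeriod t)) 0) (idx L (cubic d (evenPeriod t)) 0) ℂ))
      ((unitIdx L (cubic d (evenPeriod t))).symm (castT (cubic d (evenPeriod t)) z, μ)) ((unitIdx L (cubic d (evenPeriod t))).symm (castT (cubic d (evenPeriod t)) z', ν)))
      atTop (𝓝 s) := by
  obtain ⟨s₁, hs₁⟩ := tendsto_inv_pertCov_pair_coupling L a ha hd ha' hκ0 hγ' hδ' hJA hT₁ hT₂ hT₃ k hV₁ hV₂ hW hV₁1 hV₂1 hW1 hu μ ν z z'
  obtain ⟨s₂, hs₂⟩ := tendsto_one_pair L (d := d) tendsto_evenPeriod μ ν z z'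
  refine ⟨s₁ - a'' * s₂, ?_⟩
  simp only [Matrix.sub_apply, Matrix.smul_apply, smul_eq_mul]
  exact hs₁.sub (hs₂.const_mul a'')

/-! ## §4 THE END for the effective form with background, modulo the background's pointwise limit -/

/-- **`conv_effFormPert_of_tendsto_background` — THE EFFECTIVE FORM WITH BACKGROUND ON `ℤ^d`, MODULO ONLY THE BACKGROUND's POINTWISE LIMIT** [our proof] (`d ≥ 3`, `L ≥ 2`,
`a > 0`, `μ ≠ ν`, even cubic volumes `2(t+1)`; PART 129's coupling disc at an admissible rate; `‖u‖ ≤ T`; any regulator `a″`): for a volume-indexed family of backgrounds with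
`LipschitzBackground L (cubic d (2(t+1))) (V t) α β` (constants uniform in the volume) whose readings converge at every fixed fine integer point (`∀ k μ f z, ∃ s, V_t k μ (ẑ_t,f) → s` —
DISPLAYED), the tower `Σ_k(u) = c_k(u)⁻¹ − a″·1`, `c_k(u) = L^{dk}Q_k(Δ_a^{(k)} + u·P(V_t)^{(k)})⁻¹Q_kᴴ`, has: `δ₀ > 0`, `B, B′ ≥ 0`, limit kernels `Π_k` with
`IsInfiniteVolumeLimit evenPeriod (Re Σ_k(u)(e(·,μ′),e(0,ν′))) (Π k)`, `UniformDecay Π μ ν B (δ₀∕d)`, `StepRate Π μ ν B′ (δ₀∕d) (√(L⁻¹))`, `KernelInputs d Π` (`θ = √(L⁻¹)`,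
`c₀ = β′_d(B′∕(1−√(L⁻¹)), δ₀∕d)`), and `∀ k, |secondMoment (Π k) μ ν − secondMoment (limKernelOf Π) μ ν| ≤ β′_d(B′∕(1−√(L⁻¹)), δ₀∕d)·(√(L⁻¹))^k` — PART 140's generic END on PART 129's
(UD)+(SR) (rates matched by monotonicity) and §3's EL₂.  The `U ≠ 1` twin of PART 139, all orders in `u` on the disc. [cite: Balaban1987RG1, (1.21)–(1.22) p.264 (shapes)] -/
theorem conv_effFormPert_coupling_of_tendsto_background (hL : 2 ≤ L) (hd : 3 ≤ d) {μ ν : Fin d} (hne : μ ≠ ν) {α β α' β' a' κ T : ℝ} (ha' : 0 < a') (hκ0 : 0 < κ)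
    (hγ' : Jfree d a' κ 1 < gammaPs d a') (hδ' : deltaK d a' κ 1 < sigma0 d a' ^ 2) (hJA : JA d a a' κ 1 < gamD d a) (hT0 : 0 ≤ T)
    (hT₁ : T * (2 * (d * (α + β) * Cst d a) + α' * Cst d a) ≤ 1 / 2)
    (hT₂ : T * (d * (α * G2 d a (max (JA d a a' κ 1) 0) (gamD d a - max (JA d a a' κ 1) 0) κ)
      + d * (Real.exp |κ| * (α * G2 d a (max (JA d a a' κ 1) 0) (gamD d a - max (JA d a a' κ 1) 0) κ + β * (gamD d a - max (JA d a a' κ 1) 0)⁻¹))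
      + α' * (gamD d a - max (JA d a a' κ 1) 0)⁻¹) ≤ 1 / 2)
    (hT₃ : 4 * T * (2 * (d * (α + β) * Cst d a) + α' * Cst d a) * Cst d a ≤ gammaB d a)
    {V₁ V₂ : (t : ℕ) → (k : ℕ) → Fin d → (idx L (cubic d (evenPeriod t)) k → ℂ)} {W : (t : ℕ) → (k : ℕ) → (idx L (cubic d (evenPeriod t)) k → ℂ)}
    (hV₁ : ∀ t, LipschitzBackground L (cubic d (evenPeriod t)) (V₁ t) α β) (hV₂ : ∀ t, LipschitzBackground L (cubic d (evenPeriod t)) (V₂ t) α β)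
    (hW : ∀ t, BoundedBackground L (cubic d (evenPeriod t)) (W t) α' β')
    (hV₁1 : ∀ k (μ f : Fin d) (z : Fin d → ℤ), ∃ s : ℂ, Tendsto (fun t => V₁ t k μ (castT (cubic d (lev L k * evenPeriod t)) z, f)) atTop (𝓝 s))
    (hV₂1 : ∀ k (μ f : Fin d) (z : Fin d → ℤ), ∃ s : ℂ, Tendsto (fun t => V₂ t k μ (castT (cubic d (lev L k * evenPeriod t)) z, f)) atTop (𝓝 s))
    (hW1 : ∀ k (f : Fin d) (z : Fin d → ℤ), ∃ s : ℂ, Tendsto (fun t => W t k (castT (cubic d (lev L k * evenPeriod t)) z, f)) atTop (𝓝 s))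
    {u : ℂ} (hu : ‖u‖ ≤ T) (a'' : ℂ) :
    ∃ δ₀ B B' : ℝ, 0 < δ₀ ∧ 0 ≤ B ∧ 0 ≤ B' ∧ ∃ Pinf : ℕ → B12Beta.Kernel d,
      (∀ k, IsInfiniteVolumeLimit evenPeriod
        (fun t μ' ν' (z : Site d (evenPeriod t)) => (((avgTow (QBlev L (cubic d (evenPeriod t))) ((L : ℝ) ^ d)
            (fun k' => (calDalev L (cubic d (evenPeriod t)) a ha k' + u • (Pmodel L (cubic d (evenPeriod t)) (V₁ t) k' + (Pmodel L (cubic d (evenPeriod t)) (V₂ t) k')ᴴ + Matrix.diagonal (W t k')))⁻¹) k)⁻¹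
            - a'' • (1 : Matrix (idx L (cubic d (evenPeriod t)) 0) (idx L (cubic d (evenPeriod t)) 0) ℂ))
          ((unitIdx L (cubic d (evenPeriod t))).symm (z, μ')) ((unitIdx L (cubic d (evenPeriod t))).symm (0, ν'))).re) (Pinf k)) ∧
      Beta.LimitRate.UniformDecay Pinf μ ν B (δ₀ / d) ∧ StepRate Pinf μ ν B' (δ₀ / d) (Real.sqrt ((L : ℝ)⁻¹)) ∧
      (∃ K : KernelInputs d Pinf, K.θ = Real.sqrt ((L : ℝ)⁻¹) ∧ K.c₀ = betaPrime510 d (B' / (1 - Real.sqrt ((L : ℝ)⁻¹))) (δ₀ / d) ∧ K.Pinf = limKernelOf Pinf ∧ K.μ = μ ∧ K.ν = ν) ∧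
      (∀ k, |B12Beta.secondMoment (Pinf k) μ ν - B12Beta.secondMoment (limKernelOf Pinf) μ ν|
          ≤ betaPrime510 d (B' / (1 - Real.sqrt ((L : ℝ)⁻¹))) (δ₀ / d) * Real.sqrt ((L : ℝ)⁻¹) ^ k) := by
  have hd1 : 1 ≤ d := le_trans (by norm_num) hd
  have hd2 : 2 ≤ d := le_trans (by norm_num) hd
  have hαβ : 0 ≤ α ∧ 0 ≤ β := (hV₁ 0).nonneg
  have hαβ' : 0 ≤ α' ∧ 0 ≤ β' := (hW 0).nonneg
  have hL1 : (1 : ℝ) < L := by exact_mod_cast (lt_of_lt_of_le one_lt_two hL : 1 < L)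
  have hθ0 : 0 ≤ Real.sqrt ((L : ℝ)⁻¹) := Real.sqrt_nonneg _
  have hθ1 : Real.sqrt ((L : ℝ)⁻¹) < 1 := by
    rw [show (1 : ℝ) = Real.sqrt 1 from Real.sqrt_one.symm]
    exact Real.sqrt_lt_sqrt (inv_nonneg.mpr (Nat.cast_nonneg _)) (inv_lt_one_of_one_lt₀ hL1)
  -- PART 129: (UD) of `c_k(u)⁻¹` and (SR) of `Σ_k(u)`, volume-free on the disc
  obtain ⟨κ₁, B₁, hκ₁, hB₁, hud⟩ := exists_decay_inv_pertCov_QB_coupling L a ha hd2 hαβ hαβ' ha' hκ0 hγ' hδ' hJA hT0 hT₁ hT₂ hT₃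
  obtain ⟨κ₂, B₂, hκ₂, hsr⟩ := twoLevelDecayRate_effForm_perturbed_coupling L a ha hL hd2 hαβ hαβ' ha' hκ0 hγ' hδ' hJA hT0 hT₁ hT₂ hT₃
  -- `B₂ ≥ 0`, read off one diagonal entry
  have hB₂ : 0 ≤ B₂ := by
    have x : idx L (cubic d (evenPeriod 0)) 0 := ((fun _ => 0), ⟨0, hd1⟩)
    have h := hsr (cubic d (evenPeriod 0)) (V₁ 0) (V₂ 0) (W 0) (hV₁ 0) (hV₂ 0) (hW 0) u hu a'' 0 x x
    rw [pow_zero, mul_one, distK_self, mul_zero, neg_zero, Real.exp_zero, mul_one] at h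
    exact (norm_nonneg _).trans h
  set δ₀ : ℝ := min κ₁ (κ₂ / 2) with hδ₀
  have hδ₀0 : 0 < δ₀ := lt_min hκ₁ (half_pos hκ₂)
  refine ⟨δ₀, B₁ + ‖a''‖ * 1, B₂, hδ₀0, by positivity, hB₂, ?_⟩
  refine conv_of_decay_of_tendsto L hd1 tendsto_evenPeriod hδ₀0 hθ0 hθ1 (fun t k => ?_) (fun t => ?_) ?_ hne
  · -- (UD) at the common rate
    have h1 : EntryDecay (distK L (cubic d (evenPeriod t)))
        (avgTow (QBlev L (cubic d (evenPeriod t))) ((L : ℝ) ^ d)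
          (fun k' => (calDalev L (cubic d (evenPeriod t)) a ha k' + u • (Pmodel L (cubic d (evenPeriod t)) (V₁ t) k' + (Pmodel L (cubic d (evenPeriod t)) (V₂ t) k')ᴴ + Matrix.diagonal (W t k')))⁻¹) k)⁻¹ B₁ δ₀ :=
      entryDecay_of_le_rate (distK_nonneg L (cubic d (evenPeriod t))) (hud (cubic d (evenPeriod t)) (V₁ t) (V₂ t) (W t) (hV₁ t) (hV₂ t) (hW t) u hu k) hB₁.le (min_le_left _ _)
    have h2 : EntryDecay (distK L (cubic d (evenPeriod t))) (a'' • (1 : Matrix (idx L (cubic d (evenPeriod t)) 0) (idx L (cubic d (evenPeriod t)) 0) ℂ)) (‖a''‖ * 1) δ₀ :=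
      entryDecay_smul (entryDecay_one (distK_self L (cubic d (evenPeriod t))) δ₀) a''
    exact entryDecay_sub h1 h2
  · -- (SR) at the common rate
    exact twoLevelDecayRate_of_le_rate (distK_nonneg L (cubic d (evenPeriod t))) (hsr (cubic d (evenPeriod t)) (V₁ t) (V₂ t) (W t) (hV₁ t) (hV₂ t) (hW t) u hu a'') hB₂ hθ0
      ((min_le_right _ _).trans (le_of_eq rfl))
  · -- the entry limits at the origin pairs
    intro k μ' ν' z
    obtain ⟨s, hs⟩ := tendsto_effFormPert_pair_coupling L a ha hd ha' hκ0 hγ' hδ' hJA hT₁ hT₂ hT₃ k hV₁ hV₂ hW (hV₁1 k) (hV₂1 k) (hW1 k) hu a'' μ' ν' z 0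
    refine ⟨s, hs.congr fun t => ?_⟩
    rw [castT_zero]

end EffForm

/-! ## §2 THE INSTANCE: the effective form of the (small-field) abelian covariant vector Laplacian on the coupling disc -/

section Covariant

variable (a : ℝ) (ha : 0 < a)

/-- **`conv_effForm_covariantLaplacian_of_tendsto` — THE EFFECTIVE FORM OF `Δ_a + u·(Δ^{U_t} − Δ^1)` ON `ℤ^d` AT EVERY COUPLING OF THE DISC, MODULO ONLY EL₁ OF THE TRANSPORTERS** [our proof]
(`d ≥ 3`, `L ≥ 2`, `a > 0`, `μ ≠ ν`, even cubic volumes; PART 248's disc from the Lipschitz constants `(α, β)` of `−w_t = connV U_t` and the bounded-background constants `(α′, β′)` of `z_t = zT U_t`,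
uniform in `t`; `‖u‖ ≤ T`; any regulator `a″`): `Σ_k(u) = (L^{dk}Q_k(Δ_a^{(k)} + u·covPert U_t k)⁻¹Q_kᴴ)⁻¹ − a″1` has the β-cell's whole `LimitRate` END — §1 with `V₁ = V₂ = −w_t`, `W = z_t`
(NE2's `covPert_eq`, EXACT) and PART 239's `tendsto_connV_of_tendsto ∕ tendsto_zT_of_tendsto`.  When `T ≥ 1` is admissible (small fields) this is the effective form of Bałaban's free vector
operator with its Laplacian part replaced by the EXACT abelian covariant Laplacian, `u = 1`. [cite: Balaban1985BackgroundPropagators, (3.3) p.390 (shape); Balaban1987RG1, (1.21)–(1.22) p.264 (shapes)] -/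
theorem conv_effForm_covariantLaplacian_of_tendsto (hL : 2 ≤ L) (hd : 3 ≤ d) {μ ν : Fin d} (hne : μ ≠ ν) {α β α' β' a' κ T : ℝ} (ha' : 0 < a') (hκ0 : 0 < κ)
    (hγ' : Jfree d a' κ 1 < gammaPs d a') (hδ' : deltaK d a' κ 1 < sigma0 d a' ^ 2) (hJA : JA d a a' κ 1 < gamD d a) (hT0 : 0 ≤ T)
    (hT₁ : T * (2 * (d * (α + β) * Cst d a) + α' * Cst d a) ≤ 1 / 2)
    (hT₂ : T * (d * (α * G2 d a (max (JA d a a' κ 1) 0) (gamD d a - max (JA d a a' κ 1) 0) κ)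
      + d * (Real.exp |κ| * (α * G2 d a (max (JA d a a' κ 1) 0) (gamD d a - max (JA d a a' κ 1) 0) κ + β * (gamD d a - max (JA d a a' κ 1) 0)⁻¹))
      + α' * (gamD d a - max (JA d a a' κ 1) 0)⁻¹) ≤ 1 / 2)
    (hT₃ : 4 * T * (2 * (d * (α + β) * Cst d a) + α' * Cst d a) * Cst d a ≤ gammaB d a)
    {U : (t : ℕ) → (k : ℕ) → Fin d → (idx L (cubic d (evenPeriod t)) k → ℂ)}
    (hV : ∀ t, LipschitzBackground L (cubic d (evenPeriod t)) (connV L (cubic d (evenPeriod t)) (U t)) α β)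
    (hz : ∀ t, BoundedBackground L (cubic d (evenPeriod t)) (zT L (cubic d (evenPeriod t)) (U t)) α' β')
    (hU1 : ∀ k (μ f : Fin d) (z : Fin d → ℤ), ∃ s : ℂ, Tendsto (fun t => U t k μ (castT (cubic d (lev L k * evenPeriod t)) z, f)) atTop (𝓝 s))
    {u : ℂ} (hu : ‖u‖ ≤ T) (a'' : ℂ) :
    ∃ δ₀ B B' : ℝ, 0 < δ₀ ∧ 0 ≤ B ∧ 0 ≤ B' ∧ ∃ Pinf : ℕ → B12Beta.Kernel d,
      (∀ k, IsInfiniteVolumeLimit evenPeriod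
        (fun t μ' ν' (z : Site d (evenPeriod t)) => (((avgTow (QBlev L (cubic d (evenPeriod t))) ((L : ℝ) ^ d)
            (fun k' => (calDalev L (cubic d (evenPeriod t)) a ha k' + u • covPert L (cubic d (evenPeriod t)) (U t) k')⁻¹) k)⁻¹
            - a'' • (1 : Matrix (idx L (cubic d (evenPeriod t)) 0) (idx L (cubic d (evenPeriod t)) 0) ℂ))
          ((unitIdx L (cubic d (evenPeriod t))).symm (z, μ')) ((unitIdx L (cubic d (evenPeriod t))).symm (0, ν'))).re) (Pinf k)) ∧
      Beta.LimitRate.UniformDecay Pinf μ ν B (δ₀ / d) ∧ StepRate Pinf μ ν B' (δ₀ / d) (Real.sqrt ((L : ℝ)⁻¹)) ∧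
      (∃ K : KernelInputs d Pinf, K.θ = Real.sqrt ((L : ℝ)⁻¹) ∧ K.c₀ = betaPrime510 d (B' / (1 - Real.sqrt ((L : ℝ)⁻¹))) (δ₀ / d) ∧ K.Pinf = limKernelOf Pinf ∧ K.μ = μ ∧ K.ν = ν) ∧
      (∀ k, |B12Beta.secondMoment (Pinf k) μ ν - B12Beta.secondMoment (limKernelOf Pinf) μ ν|
          ≤ betaPrime510 d (B' / (1 - Real.sqrt ((L : ℝ)⁻¹))) (δ₀ / d) * Real.sqrt ((L : ℝ)⁻¹) ^ k) := by
  have e : ∀ t k', covPert L (cubic d (evenPeriod t)) (U t) k'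
      = Pmodel L (cubic d (evenPeriod t)) (connV L (cubic d (evenPeriod t)) (U t)) k' + (Pmodel L (cubic d (evenPeriod t)) (connV L (cubic d (evenPeriod t)) (U t)) k')ᴴ
        + Matrix.diagonal (zT L (cubic d (evenPeriod t)) (U t) k') := fun t k' => covPert_eq L (cubic d (evenPeriod t)) (U t) k'
  simp only [e]
  exact conv_effFormPert_coupling_of_tendsto_background L a ha hL hd hne ha' hκ0 hγ' hδ' hJA hT0 hT₁ hT₂ hT₃ hV hV hz
    (tendsto_connV_of_tendsto L hU1) (tendsto_connV_of_tendsto L hU1) (tendsto_zT_of_tendsto L hU1) hu a''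

end Covariant

end Summit.QuantumFields.BalabanUV.Beta.GAN24.CouplingEffectiveFormVolumeLimit

end
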